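import Summits.QuantumFields.YangMills.Theorems.BalabanUVNodesN21ResponseRoadAtSUNBlockChart

/-!
# N21 (NE7c) · the response road's ★★★ (`hRT`) and ★★★★ ((M1)) READ AT THE LANE's `SU(N)` BLOCK CHART: file 8's two
# junctions with the chart data DISCHARGED by file 10 (`Ξ := Ξ_N`, `v = v′ = 1`), exterior-dependent centre `u₀ z`,
# base `updateFinset (xext z) Λ (u₀ z)` — the ONE NODE-O-shaped clause now displayed on configurations `PBond → M_N(ℂ)`

Width seat `pub-ymgap-dag-n21-w3` (g2), node N21 = NE7c (NOT PRINTED in [Bałaban 1983–89], NOT proved), lane K3⁷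
`SpineGivenEndpointR13SepCoPH` (stmt-QuantumFields-20544, `--kind proof --supports … --as helper`).  File 12 of this
seat's response road; consumes BY NAME file 8 (★★★ `hRT_of_blockExpChart_regular`, ★★★★
`slotAntiConcentration_restrict_of_projectedCentre_blockExpChart_regular`) and file 10 (`dirLetter_nonneg`,
`sum_norm_blockDir_le`, `norm_baseUnit_le_one`, `norm_inv_baseUnit_le_one`; the dictionary
`updateFinset_expFibreChartSU(_unflat)_eq_blockExpChart` rewrites every configuration below into
`updateFinset (xext z) Λ (expFibreChartSU Λ (u₀ z) ·)`).

WHAT IS PROVED ([bookkeeping]; 0 def, 0 sorry; exterior parameter `z : Z` abstract with maps `xext u₀ : Z → GaugeField`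
— the exterior field and the chart centre may both depend on it; block coordinates `κ = ↥Λ × Fin d_N`; `N ≥ 1`).
* §0 `blockExpChart_flat_zero`: at the flat origin the chart-form configuration is the base `V₀` (so with centre
  `c z = 0` the core reading and the centre's regularity are read on the data `updateFinset (xext z) Λ (u₀ z)`).
* §1 ★★★ `hRT_at_expFibreChartSU`: part 34's radial-transversality binder for
  `U p = ⨆_q ‖Ψ q p.1 (configuration of record at exterior p.1, flat chart point p.2)‖` from: the NODE-O-shaped clause
  «`Ψ q z` complex differentiable on the regular set `{V : PBond → M_N(ℂ) | units ∧ ‖∂V(p) − 1‖ < ε on plaqs}` with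
  `‖Ψ q z‖ ≤ S`» + cut bound `ϱ` + base `δ`-regularity on the cut + smallness∕budget at `ϱ` with `Ξ_N`, `v = v′ = 1` +
  file 2's cut letters + the numeral `c₀ + 4(4S∕r²)R² ≤ (1−κ₀)θ(1−ρ)` — NO chart-letter hypothesis left.
* §2 ★★★★ `slotAC_at_expFibreChartSU`: part 34's (M1) for the same `U` with `hRT` discharged by §1's road; part 34's
  other binders (coercivity, Lipschitz cut action, obtuseness, farness, envelope, odds, measurability) displayed unchanged.

HONEST FRAMING.  [bookkeeping] instantiation BY NAME; the NODE-O clause, base regularity, numeral and part 34's binders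
are displayed HYPOTHESES; located dictionary (`ε ↔ a₁`, `δ ↔ ε₁`, `S ↔ B₃εσ`) NOT asserted; nothing of Bałaban's
asserted; (M1) ∕ NE7c NOT PRINTED ∕ NOT proved; N21 NOT discharged; K3⁷ NOT claimed; counts unmoved (typed 28∕28 ·
discharged 5∕27); count-neutral; one finite 𝕋⁴ at fixed ε — YM mass gap (Clay) is NOT proved by any of this: R4 closes
the conditional finite-𝕋⁴ rung `BalabanLadder.UV` only; nothing continuum ∕ ℝ⁴ ∕ OS ∕ mass gap ∕ Clay.
-/

open scoped Matrix.Norms.L2Operator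

noncomputable section

open NormedSpace Metric Set MeasureTheory Matrix
open scoped ENNReal

namespace Summit.QuantumFields.YangMills.Theorems.N21ResponseRoadAtSUNBlockChartRT

open Literature.MathematicalPhysics.QuantumFieldTheory.Balaban1983to89
open T4ShellMeasure (SlotAntiConcentration)
open T4AdjointCovarianceUnitary (toUnitary)
open Summit.QuantumFields.BalabanUV.T4Continuum.ShellMeasureExpChartSUN
open Summit.QuantumFields.YangMills.Theorems.N21ResponseRoadAtRegularSet
  (hRT_of_blockExpChart_regular slotAntiConcentration_restrict_of_projectedCentre_blockExpChart_regular)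
open Summit.QuantumFields.YangMills.Theorems.N21ResponseRoadAtSUNBlockChart
  (sum_norm_blockDir_le norm_baseUnit_le_one norm_inv_baseUnit_le_one dirLetter_nonneg)

variable {N : ℕ} [NeZero N] {P : Params} {j : ℕ} [DecidableEq (PBond P j)] {Z : Type*}

/-! ## §0  The chart centre in the flat frame: at `y = 0` the chart-form configuration is the base -/

/-- **AT THE FLAT ORIGIN THE CHART-FORM CONFIGURATION IS THE BASE `V₀`** (any algebra, any directions): so when the
cut's centre is `c z = 0` the core reading `hc₀` and the base regularity at the centre (file 9
`baseRegularity_of_centre`) are read on the DATA `V₀ z = updateFinset (xext z) Λ (u₀ z)` (file 10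
`updateFinset_expFibreChartSU_unflat_zero`). [bookkeeping] -/
theorem blockExpChart_flat_zero {𝔄 : Type*} [NormedRing 𝔄] [NormedAlgebra ℂ 𝔄] {κ B : Type*} [Fintype κ]
    (X : κ → B → 𝔄) (V₀ : B → 𝔄ˣ) :
    (fun b => exp (∑ a, (((0 : κ → ℝ) a : ℝ) : ℂ) • X a b) * (V₀ b : 𝔄)) = fun b => (V₀ b : 𝔄) := by
  funext b
  simp

/-! ## §1  ★★★ at the `SU(N)` block chart -/

/-- ★★★ **PART 34's `hRT` FOR THE CUBE SUP OF PLAQUETTE READINGS OF THE MINIMISER THROUGH THE LANE's `SU(N)` BLOCK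
CHART** (file 8 ★★★ with `Xd z`, `V₀ z` := file 10's directions and base at the centre `u₀ z` and exterior
`xext z`; chart letters `Ξ_N`, `v = v′ = 1` DISCHARGED by file 10 §2).  Every configuration below is
`updateFinset (xext z) Λ (expFibreChartSU Λ (u₀ z) ·)` read at the flat chart point (file 10
`updateFinset_expFibreChartSU_unflat_eq_blockExpChart`). [bookkeeping] -/
theorem hRT_at_expFibreChartSU {Pq E : Type*} [NormedAddCommGroup E] [NormedSpace ℂ E] [CompleteSpace E]
    [Fintype Pq] [Nonempty Pq] (Λ : Finset (PBond P j)) (xext u₀ : Z → GaugeField P j (SUN N))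
    {r S δ ε ϱ R c₀ θ ρ κ₀ : ℝ} (hr : 0 < r) (hS0 : 0 ≤ S)
    (hsmall : (∑ a : Fin (dimSU N), ‖genSU (EuclideanSpace.single a (1 : ℝ))‖) * Real.exp ((ϱ + r) * (∑ a : Fin (dimSU N), ‖genSU (EuclideanSpace.single a (1 : ℝ))‖)) * 1 * r * (1 * Real.exp (ϱ * (∑ a : Fin (dimSU N), ‖genSU (EuclideanSpace.single a (1 : ℝ))‖))) ≤ 1 / 2)
    (plaqs : Finset (PBond P j × PBond P j × PBond P j × PBond P j))
    (hbudget : δ + max (Real.exp (ϱ * (∑ a : Fin (dimSU N), ‖genSU (EuclideanSpace.single a (1 : ℝ))‖)) * 1 + (∑ a : Fin (dimSU N), ‖genSU (EuclideanSpace.single a (1 : ℝ))‖) * Real.exp ((ϱ + r) * (∑ a : Fin (dimSU N), ‖genSU (EuclideanSpace.single a (1 : ℝ))‖)) * 1 * r)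
        (2 * (1 * Real.exp (ϱ * (∑ a : Fin (dimSU N), ‖genSU (EuclideanSpace.single a (1 : ℝ))‖)))) ^ 3 * (2 + 4 * (1 * Real.exp (ϱ * (∑ a : Fin (dimSU N), ‖genSU (EuclideanSpace.single a (1 : ℝ))‖))) ^ 2) *
        ((∑ a : Fin (dimSU N), ‖genSU (EuclideanSpace.single a (1 : ℝ))‖) * Real.exp ((ϱ + r) * (∑ a : Fin (dimSU N), ‖genSU (EuclideanSpace.single a (1 : ℝ))‖)) * 1 * r) < ε)
    (Ψ : Pq → Z → (PBond P j → Matrix (Fin N) (Fin N) ℂ) → E)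
    (hΨd : ∀ q z, DifferentiableOn ℂ (Ψ q z) {V : PBond P j → Matrix (Fin N) (Fin N) ℂ | (∀ b, IsUnit (V b)) ∧ ∀ p ∈ plaqs,
      ‖V p.1 * V p.2.1 * Ring.inverse (V p.2.2.1) * Ring.inverse (V p.2.2.2) - 1‖ < ε})
    (hΨS : ∀ q z, ∀ V ∈ {V : PBond P j → Matrix (Fin N) (Fin N) ℂ | (∀ b, IsUnit (V b)) ∧ ∀ p ∈ plaqs,
      ‖V p.1 * V p.2.1 * Ring.inverse (V p.2.2.1) * Ring.inverse (V p.2.2.2) - 1‖ < ε}, ‖Ψ q z V‖ ≤ S)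
    (K : Z → Set (↥Λ × Fin (dimSU N) → ℝ)) (hKϱ : ∀ z, ∀ x ∈ K z, ‖x‖ ≤ ϱ)
    (hreg : ∀ z, ∀ x ∈ K z, ∀ p ∈ plaqs,
      ‖(fun bond => exp (∑ i : ↥Λ × Fin (dimSU N), ((x i : ℝ) : ℂ) • (fun (z : Z) (i : ↥Λ × Fin (dimSU N)) (bond : PBond P j) =>
        if bond = (i.1 : PBond P j) then
          (u₀ z i.1 : Matrix (Fin N) (Fin N) ℂ) * genSU (EuclideanSpace.single i.2 (1 : ℝ)) *
            star (u₀ z i.1 : Matrix (Fin N) (Fin N) ℂ) else 0) z i bond) * (((fun (z : Z) (bond : PBond P j) =>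
        Unitary.toUnits (toUnitary (Function.updateFinset (xext z) Λ (fun b' : ↥Λ => u₀ z (b' : PBond P j)) bond))) z bond : (Matrix (Fin N) (Fin N) ℂ)ˣ) : Matrix (Fin N) (Fin N) ℂ)) p.1 * (fun bond => exp (∑ i : ↥Λ × Fin (dimSU N), ((x i : ℝ) : ℂ) • (fun (z : Z) (i : ↥Λ × Fin (dimSU N)) (bond : PBond P j) =>
        if bond = (i.1 : PBond P j) then
          (u₀ z i.1 : Matrix (Fin N) (Fin N) ℂ) * genSU (EuclideanSpace.single i.2 (1 : ℝ)) *
            star (u₀ z i.1 : Matrix (Fin N) (Fin N) ℂ) else 0) z i bond) * (((fun (z : Z) (bond : PBond P j) =>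
        Unitary.toUnits (toUnitary (Function.updateFinset (xext z) Λ (fun b' : ↥Λ => u₀ z (b' : PBond P j)) bond))) z bond : (Matrix (Fin N) (Fin N) ℂ)ˣ) : Matrix (Fin N) (Fin N) ℂ)) p.2.1 *
        Ring.inverse ((fun bond => exp (∑ i : ↥Λ × Fin (dimSU N), ((x i : ℝ) : ℂ) • (fun (z : Z) (i : ↥Λ × Fin (dimSU N)) (bond : PBond P j) =>
        if bond = (i.1 : PBond P j) then
          (u₀ z i.1 : Matrix (Fin N) (Fin N) ℂ) * genSU (EuclideanSpace.single i.2 (1 : ℝ)) *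
            star (u₀ z i.1 : Matrix (Fin N) (Fin N) ℂ) else 0) z i bond) * (((fun (z : Z) (bond : PBond P j) =>
        Unitary.toUnits (toUnitary (Function.updateFinset (xext z) Λ (fun b' : ↥Λ => u₀ z (b' : PBond P j)) bond))) z bond : (Matrix (Fin N) (Fin N) ℂ)ˣ) : Matrix (Fin N) (Fin N) ℂ)) p.2.2.1) * Ring.inverse ((fun bond => exp (∑ i : ↥Λ × Fin (dimSU N), ((x i : ℝ) : ℂ) • (fun (z : Z) (i : ↥Λ × Fin (dimSU N)) (bond : PBond P j) =>
        if bond = (i.1 : PBond P j) then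
          (u₀ z i.1 : Matrix (Fin N) (Fin N) ℂ) * genSU (EuclideanSpace.single i.2 (1 : ℝ)) *
            star (u₀ z i.1 : Matrix (Fin N) (Fin N) ℂ) else 0) z i bond) * (((fun (z : Z) (bond : PBond P j) =>
        Unitary.toUnits (toUnitary (Function.updateFinset (xext z) Λ (fun b' : ↥Λ => u₀ z (b' : PBond P j)) bond))) z bond : (Matrix (Fin N) (Fin N) ℂ)ˣ) : Matrix (Fin N) (Fin N) ℂ)) p.2.2.2) - 1‖ ≤ δ)
    (c : Z → (↥Λ × Fin (dimSU N) → ℝ)) (hcK : ∀ z, c z ∈ K z)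
    (hKR : ∀ z, ∀ w ∈ K z, ‖w - c z‖ ≤ R) (hRr : 2 * R < r)
    (hc₀ : ∀ q z, ‖Ψ q z (fun bond => exp (∑ i : ↥Λ × Fin (dimSU N), (((c z) i : ℝ) : ℂ) • (fun (z : Z) (i : ↥Λ × Fin (dimSU N)) (bond : PBond P j) =>
        if bond = (i.1 : PBond P j) then
          (u₀ z i.1 : Matrix (Fin N) (Fin N) ℂ) * genSU (EuclideanSpace.single i.2 (1 : ℝ)) *
            star (u₀ z i.1 : Matrix (Fin N) (Fin N) ℂ) else 0) z i bond) * (((fun (z : Z) (bond : PBond P j) =>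
        Unitary.toUnits (toUnitary (Function.updateFinset (xext z) Λ (fun b' : ↥Λ => u₀ z (b' : PBond P j)) bond))) z bond : (Matrix (Fin N) (Fin N) ℂ)ˣ) : Matrix (Fin N) (Fin N) ℂ))‖ ≤ c₀)
    {C : Set (Z × (↥Λ × Fin (dimSU N) → ℝ))} (hCK : ∀ p ∈ C, p.2 ∈ K p.1)
    (hnum : c₀ + 4 * (2 * (2 * S) / r ^ 2) * R ^ 2 ≤ (1 - κ₀) * (θ * (1 - ρ))) :
    ∀ p : Z × (↥Λ × Fin (dimSU N) → ℝ), θ * (1 - ρ) ≤ (⨆ q, ‖Ψ q p.1 (fun bond => exp (∑ i : ↥Λ × Fin (dimSU N), ((p.2 i : ℝ) : ℂ) • (fun (z : Z) (i : ↥Λ × Fin (dimSU N)) (bond : PBond P j) =>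
        if bond = (i.1 : PBond P j) then
          (u₀ z i.1 : Matrix (Fin N) (Fin N) ℂ) * genSU (EuclideanSpace.single i.2 (1 : ℝ)) *
            star (u₀ z i.1 : Matrix (Fin N) (Fin N) ℂ) else 0) p.1 i bond) * (((fun (z : Z) (bond : PBond P j) =>
        Unitary.toUnits (toUnitary (Function.updateFinset (xext z) Λ (fun b' : ↥Λ => u₀ z (b' : PBond P j)) bond))) p.1 bond : (Matrix (Fin N) (Fin N) ℂ)ˣ) : Matrix (Fin N) (Fin N) ℂ))‖) → (⨆ q, ‖Ψ q p.1 (fun bond => exp (∑ i : ↥Λ × Fin (dimSU N), ((p.2 i : ℝ) : ℂ) • (fun (z : Z) (i : ↥Λ × Fin (dimSU N)) (bond : PBond P j) =>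
        if bond = (i.1 : PBond P j) then
          (u₀ z i.1 : Matrix (Fin N) (Fin N) ℂ) * genSU (EuclideanSpace.single i.2 (1 : ℝ)) *
            star (u₀ z i.1 : Matrix (Fin N) (Fin N) ℂ) else 0) p.1 i bond) * (((fun (z : Z) (bond : PBond P j) =>
        Unitary.toUnits (toUnitary (Function.updateFinset (xext z) Λ (fun b' : ↥Λ => u₀ z (b' : PBond P j)) bond))) p.1 bond : (Matrix (Fin N) (Fin N) ℂ)ˣ) : Matrix (Fin N) (Fin N) ℂ))‖) < θ → p ∈ C →
      ∀ s : ℝ, 1 ≤ s → θ * (1 - ρ) ≤ (⨆ q, ‖Ψ q p.1 (fun bond => exp (∑ i : ↥Λ × Fin (dimSU N), (((c p.1 + s • (p.2 - c p.1)) i : ℝ) : ℂ) • (fun (z : Z) (i : ↥Λ × Fin (dimSU N)) (bond : PBond P j) =>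
        if bond = (i.1 : PBond P j) then
          (u₀ z i.1 : Matrix (Fin N) (Fin N) ℂ) * genSU (EuclideanSpace.single i.2 (1 : ℝ)) *
            star (u₀ z i.1 : Matrix (Fin N) (Fin N) ℂ) else 0) p.1 i bond) * (((fun (z : Z) (bond : PBond P j) =>
        Unitary.toUnits (toUnitary (Function.updateFinset (xext z) Λ (fun b' : ↥Λ => u₀ z (b' : PBond P j)) bond))) p.1 bond : (Matrix (Fin N) (Fin N) ℂ)ˣ) : Matrix (Fin N) (Fin N) ℂ))‖) → (⨆ q, ‖Ψ q p.1 (fun bond => exp (∑ i : ↥Λ × Fin (dimSU N), (((c p.1 + s • (p.2 - c p.1)) i : ℝ) : ℂ) • (fun (z : Z) (i : ↥Λ × Fin (dimSU N)) (bond : PBond P j) =>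
        if bond = (i.1 : PBond P j) then
          (u₀ z i.1 : Matrix (Fin N) (Fin N) ℂ) * genSU (EuclideanSpace.single i.2 (1 : ℝ)) *
            star (u₀ z i.1 : Matrix (Fin N) (Fin N) ℂ) else 0) p.1 i bond) * (((fun (z : Z) (bond : PBond P j) =>
        Unitary.toUnits (toUnitary (Function.updateFinset (xext z) Λ (fun b' : ↥Λ => u₀ z (b' : PBond P j)) bond))) p.1 bond : (Matrix (Fin N) (Fin N) ℂ)ˣ) : Matrix (Fin N) (Fin N) ℂ))‖) < θ → (p.1, c p.1 + s • (p.2 - c p.1)) ∈ C →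
        (⨆ q, ‖Ψ q p.1 (fun bond => exp (∑ i : ↥Λ × Fin (dimSU N), ((p.2 i : ℝ) : ℂ) • (fun (z : Z) (i : ↥Λ × Fin (dimSU N)) (bond : PBond P j) =>
        if bond = (i.1 : PBond P j) then
          (u₀ z i.1 : Matrix (Fin N) (Fin N) ℂ) * genSU (EuclideanSpace.single i.2 (1 : ℝ)) *
            star (u₀ z i.1 : Matrix (Fin N) (Fin N) ℂ) else 0) p.1 i bond) * (((fun (z : Z) (bond : PBond P j) =>
        Unitary.toUnits (toUnitary (Function.updateFinset (xext z) Λ (fun b' : ↥Λ => u₀ z (b' : PBond P j)) bond))) p.1 bond : (Matrix (Fin N) (Fin N) ℂ)ˣ) : Matrix (Fin N) (Fin N) ℂ))‖) + κ₀ * (θ * (1 - ρ)) * (s - 1) ≤ (⨆ q, ‖Ψ q p.1 (fun bond => exp (∑ i : ↥Λ × Fin (dimSU N), (((c p.1 + s • (p.2 - c p.1)) i : ℝ) : ℂ) • (fun (z : Z) (i : ↥Λ × Fin (dimSU N)) (bond : PBond P j) =>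
        if bond = (i.1 : PBond P j) then
          (u₀ z i.1 : Matrix (Fin N) (Fin N) ℂ) * genSU (EuclideanSpace.single i.2 (1 : ℝ)) *
            star (u₀ z i.1 : Matrix (Fin N) (Fin N) ℂ) else 0) p.1 i bond) * (((fun (z : Z) (bond : PBond P j) =>
        Unitary.toUnits (toUnitary (Function.updateFinset (xext z) Λ (fun b' : ↥Λ => u₀ z (b' : PBond P j)) bond))) p.1 bond : (Matrix (Fin N) (Fin N) ℂ)ˣ) : Matrix (Fin N) (Fin N) ℂ))‖) :=
  hRT_of_blockExpChart_regular (𝔄 := Matrix (Fin N) (Fin N) ℂ) (fun (z : Z) (i : ↥Λ × Fin (dimSU N)) (bond : PBond P j) =>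
        if bond = (i.1 : PBond P j) then
          (u₀ z i.1 : Matrix (Fin N) (Fin N) ℂ) * genSU (EuclideanSpace.single i.2 (1 : ℝ)) *
            star (u₀ z i.1 : Matrix (Fin N) (Fin N) ℂ) else 0) (fun (z : Z) (bond : PBond P j) =>
        Unitary.toUnits (toUnitary (Function.updateFinset (xext z) Λ (fun b' : ↥Λ => u₀ z (b' : PBond P j)) bond)))
    dirLetter_nonneg (fun z bond => sum_norm_blockDir_le Λ (u₀ z) bond) zero_le_one
    (fun z bond => norm_baseUnit_le_one Λ (u₀ z) (xext z) bond)
    (fun z bond => norm_inv_baseUnit_le_one Λ (u₀ z) (xext z) bond)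
    hr hS0 hsmall plaqs hbudget Ψ hΨd hΨS K hKϱ hreg c hcK hKR hRr hc₀ hCK hnum

/-! ## §2  ★★★★ at the `SU(N)` block chart -/

/-- ★★★★ **PART 34's (M1) FOR THE CUBE SUP OF PLAQUETTE READINGS OF THE MINIMISER THROUGH THE LANE's `SU(N)` BLOCK
CHART** (file 8 ★★★★ with the chart data DISCHARGED by file 10; `hRT` DISCHARGED by §1's road; part 34's other
binders — coercivity, Lipschitz cut action, obtuseness, farness, envelope, odds, measurability — displayed unchanged on
the frame `Z × (↥Λ × Fin d_N → ℝ)` with exterior law `ζ`).  LOCATED junction; A2 for the NODE-O clause: file 8 §5.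
[bookkeeping] -/
theorem slotAC_at_expFibreChartSU {Pq E : Type*} [NormedAddCommGroup E] [NormedSpace ℂ E] [CompleteSpace E]
    [Fintype Pq] [Nonempty Pq] [MeasurableSpace Z] (Λ : Finset (PBond P j)) [Nonempty (↥Λ × Fin (dimSU N))]
    (xext u₀ : Z → GaugeField P j (SUN N))
    (ζ : Measure Z) [SFinite ζ] (A : Matrix (↥Λ × Fin (dimSU N)) (↥Λ × Fin (dimSU N)) ℝ) (hA : A.IsSymm)
    {γ G : ℝ} (hγ0 : 0 < γ) (hγ : ∀ x : ↥Λ × Fin (dimSU N) → ℝ, γ * ‖x‖ ^ 2 ≤ x ⬝ᵥ (A *ᵥ x))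
    (m : Z → (↥Λ × Fin (dimSU N) → ℝ)) {c : Z → (↥Λ × Fin (dimSU N) → ℝ)} (hc : Measurable c)
    (Pz : Z → (↥Λ × Fin (dimSU N) → ℝ) → ℝ)
    {r S δ ε ϱ R c₀ θ ρ κ₀ : ℝ} (hr : 0 < r) (hS0 : 0 ≤ S)
    (hsmall : (∑ a : Fin (dimSU N), ‖genSU (EuclideanSpace.single a (1 : ℝ))‖) * Real.exp ((ϱ + r) * (∑ a : Fin (dimSU N), ‖genSU (EuclideanSpace.single a (1 : ℝ))‖)) * 1 * r * (1 * Real.exp (ϱ * (∑ a : Fin (dimSU N), ‖genSU (EuclideanSpace.single a (1 : ℝ))‖))) ≤ 1 / 2)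
    (plaqs : Finset (PBond P j × PBond P j × PBond P j × PBond P j))
    (hbudget : δ + max (Real.exp (ϱ * (∑ a : Fin (dimSU N), ‖genSU (EuclideanSpace.single a (1 : ℝ))‖)) * 1 + (∑ a : Fin (dimSU N), ‖genSU (EuclideanSpace.single a (1 : ℝ))‖) * Real.exp ((ϱ + r) * (∑ a : Fin (dimSU N), ‖genSU (EuclideanSpace.single a (1 : ℝ))‖)) * 1 * r)
        (2 * (1 * Real.exp (ϱ * (∑ a : Fin (dimSU N), ‖genSU (EuclideanSpace.single a (1 : ℝ))‖)))) ^ 3 * (2 + 4 * (1 * Real.exp (ϱ * (∑ a : Fin (dimSU N), ‖genSU (EuclideanSpace.single a (1 : ℝ))‖))) ^ 2) *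
        ((∑ a : Fin (dimSU N), ‖genSU (EuclideanSpace.single a (1 : ℝ))‖) * Real.exp ((ϱ + r) * (∑ a : Fin (dimSU N), ‖genSU (EuclideanSpace.single a (1 : ℝ))‖)) * 1 * r) < ε)
    (Ψ : Pq → Z → (PBond P j → Matrix (Fin N) (Fin N) ℂ) → E)
    (hΨd : ∀ q z, DifferentiableOn ℂ (Ψ q z) {V : PBond P j → Matrix (Fin N) (Fin N) ℂ | (∀ b, IsUnit (V b)) ∧ ∀ p ∈ plaqs,
      ‖V p.1 * V p.2.1 * Ring.inverse (V p.2.2.1) * Ring.inverse (V p.2.2.2) - 1‖ < ε})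
    (hΨS : ∀ q z, ∀ V ∈ {V : PBond P j → Matrix (Fin N) (Fin N) ℂ | (∀ b, IsUnit (V b)) ∧ ∀ p ∈ plaqs,
      ‖V p.1 * V p.2.1 * Ring.inverse (V p.2.2.1) * Ring.inverse (V p.2.2.2) - 1‖ < ε}, ‖Ψ q z V‖ ≤ S)
    (K : Z → Set (↥Λ × Fin (dimSU N) → ℝ)) (hKϱ : ∀ z, ∀ x ∈ K z, ‖x‖ ≤ ϱ)
    (hreg : ∀ z, ∀ x ∈ K z, ∀ p ∈ plaqs,
      ‖(fun bond => exp (∑ i : ↥Λ × Fin (dimSU N), ((x i : ℝ) : ℂ) • (fun (z : Z) (i : ↥Λ × Fin (dimSU N)) (bond : PBond P j) =>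
        if bond = (i.1 : PBond P j) then
          (u₀ z i.1 : Matrix (Fin N) (Fin N) ℂ) * genSU (EuclideanSpace.single i.2 (1 : ℝ)) *
            star (u₀ z i.1 : Matrix (Fin N) (Fin N) ℂ) else 0) z i bond) * (((fun (z : Z) (bond : PBond P j) =>
        Unitary.toUnits (toUnitary (Function.updateFinset (xext z) Λ (fun b' : ↥Λ => u₀ z (b' : PBond P j)) bond))) z bond : (Matrix (Fin N) (Fin N) ℂ)ˣ) : Matrix (Fin N) (Fin N) ℂ)) p.1 * (fun bond => exp (∑ i : ↥Λ × Fin (dimSU N), ((x i : ℝ) : ℂ) • (fun (z : Z) (i : ↥Λ × Fin (dimSU N)) (bond : PBond P j) =>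
        if bond = (i.1 : PBond P j) then
          (u₀ z i.1 : Matrix (Fin N) (Fin N) ℂ) * genSU (EuclideanSpace.single i.2 (1 : ℝ)) *
            star (u₀ z i.1 : Matrix (Fin N) (Fin N) ℂ) else 0) z i bond) * (((fun (z : Z) (bond : PBond P j) =>
        Unitary.toUnits (toUnitary (Function.updateFinset (xext z) Λ (fun b' : ↥Λ => u₀ z (b' : PBond P j)) bond))) z bond : (Matrix (Fin N) (Fin N) ℂ)ˣ) : Matrix (Fin N) (Fin N) ℂ)) p.2.1 *
        Ring.inverse ((fun bond => exp (∑ i : ↥Λ × Fin (dimSU N), ((x i : ℝ) : ℂ) • (fun (z : Z) (i : ↥Λ × Fin (dimSU N)) (bond : PBond P j) =>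
        if bond = (i.1 : PBond P j) then
          (u₀ z i.1 : Matrix (Fin N) (Fin N) ℂ) * genSU (EuclideanSpace.single i.2 (1 : ℝ)) *
            star (u₀ z i.1 : Matrix (Fin N) (Fin N) ℂ) else 0) z i bond) * (((fun (z : Z) (bond : PBond P j) =>
        Unitary.toUnits (toUnitary (Function.updateFinset (xext z) Λ (fun b' : ↥Λ => u₀ z (b' : PBond P j)) bond))) z bond : (Matrix (Fin N) (Fin N) ℂ)ˣ) : Matrix (Fin N) (Fin N) ℂ)) p.2.2.1) * Ring.inverse ((fun bond => exp (∑ i : ↥Λ × Fin (dimSU N), ((x i : ℝ) : ℂ) • (fun (z : Z) (i : ↥Λ × Fin (dimSU N)) (bond : PBond P j) =>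
        if bond = (i.1 : PBond P j) then
          (u₀ z i.1 : Matrix (Fin N) (Fin N) ℂ) * genSU (EuclideanSpace.single i.2 (1 : ℝ)) *
            star (u₀ z i.1 : Matrix (Fin N) (Fin N) ℂ) else 0) z i bond) * (((fun (z : Z) (bond : PBond P j) =>
        Unitary.toUnits (toUnitary (Function.updateFinset (xext z) Λ (fun b' : ↥Λ => u₀ z (b' : PBond P j)) bond))) z bond : (Matrix (Fin N) (Fin N) ℂ)ˣ) : Matrix (Fin N) (Fin N) ℂ)) p.2.2.2) - 1‖ ≤ δ)
    (hg : Measurable (fun p : Z × (↥Λ × Fin (dimSU N) → ℝ) => (K p.1).indicator (fun w => ENNReal.ofReal (Real.exp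
        (-(1 / 2 * ((w - m p.1) ⬝ᵥ (A *ᵥ (w - m p.1))) + Pz p.1 w)))) p.2))
    (hKR : ∀ z, ∀ w ∈ K z, ‖w - c z‖ ≤ R) (hRr : 2 * R < r)
    (hc₀ : ∀ q z, ‖Ψ q z (fun bond => exp (∑ i : ↥Λ × Fin (dimSU N), (((c z) i : ℝ) : ℂ) • (fun (z : Z) (i : ↥Λ × Fin (dimSU N)) (bond : PBond P j) =>
        if bond = (i.1 : PBond P j) then
          (u₀ z i.1 : Matrix (Fin N) (Fin N) ℂ) * genSU (EuclideanSpace.single i.2 (1 : ℝ)) *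
            star (u₀ z i.1 : Matrix (Fin N) (Fin N) ℂ) else 0) z i bond) * (((fun (z : Z) (bond : PBond P j) =>
        Unitary.toUnits (toUnitary (Function.updateFinset (xext z) Λ (fun b' : ↥Λ => u₀ z (b' : PBond P j)) bond))) z bond : (Matrix (Fin N) (Fin N) ℂ)ˣ) : Matrix (Fin N) (Fin N) ℂ))‖ ≤ c₀)
    (hUm : Measurable fun p : Z × (↥Λ × Fin (dimSU N) → ℝ) => (⨆ q, ‖Ψ q p.1 (fun bond => exp (∑ i : ↥Λ × Fin (dimSU N), ((p.2 i : ℝ) : ℂ) • (fun (z : Z) (i : ↥Λ × Fin (dimSU N)) (bond : PBond P j) =>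
        if bond = (i.1 : PBond P j) then
          (u₀ z i.1 : Matrix (Fin N) (Fin N) ℂ) * genSU (EuclideanSpace.single i.2 (1 : ℝ)) *
            star (u₀ z i.1 : Matrix (Fin N) (Fin N) ℂ) else 0) p.1 i bond) * (((fun (z : Z) (bond : PBond P j) =>
        Unitary.toUnits (toUnitary (Function.updateFinset (xext z) Λ (fun b' : ↥Λ => u₀ z (b' : PBond P j)) bond))) p.1 bond : (Matrix (Fin N) (Fin N) ℂ)ˣ) : Matrix (Fin N) (Fin N) ℂ))‖))
    {C Env : Set (Z × (↥Λ × Fin (dimSU N) → ℝ))} (hC : MeasurableSet C) (hEnv : MeasurableSet Env)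
    (hCK : ∀ p ∈ C, p.2 ∈ K p.1)
    {Q : ℝ} (hθ : 0 < θ) (hρ0 : 0 < ρ) (hρ1 : ρ < 1) (hκ : 0 < κ₀) (hQ0 : 0 ≤ Q)
    (hnum : c₀ + 4 * (2 * (2 * S) / r ^ 2) * R ^ 2 ≤ (1 - κ₀) * (θ * (1 - ρ)))
    (hK : ∀ z, Convex ℝ (K z)) (hcK : ∀ z, c z ∈ K z)
    (hP : ∀ z, ∀ v ∈ K z, ∀ v' ∈ K z, Pz z v - Pz z v' ≤ G * ‖v - v'‖)
    (hobt : ∀ p : Z × (↥Λ × Fin (dimSU N) → ℝ), θ * (1 - ρ) ≤ (⨆ q, ‖Ψ q p.1 (fun bond => exp (∑ i : ↥Λ × Fin (dimSU N), ((p.2 i : ℝ) : ℂ) • (fun (z : Z) (i : ↥Λ × Fin (dimSU N)) (bond : PBond P j) =>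
        if bond = (i.1 : PBond P j) then
          (u₀ z i.1 : Matrix (Fin N) (Fin N) ℂ) * genSU (EuclideanSpace.single i.2 (1 : ℝ)) *
            star (u₀ z i.1 : Matrix (Fin N) (Fin N) ℂ) else 0) p.1 i bond) * (((fun (z : Z) (bond : PBond P j) =>
        Unitary.toUnits (toUnitary (Function.updateFinset (xext z) Λ (fun b' : ↥Λ => u₀ z (b' : PBond P j)) bond))) p.1 bond : (Matrix (Fin N) (Fin N) ℂ)ˣ) : Matrix (Fin N) (Fin N) ℂ))‖) → (⨆ q, ‖Ψ q p.1 (fun bond => exp (∑ i : ↥Λ × Fin (dimSU N), ((p.2 i : ℝ) : ℂ) • (fun (z : Z) (i : ↥Λ × Fin (dimSU N)) (bond : PBond P j) =>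
        if bond = (i.1 : PBond P j) then
          (u₀ z i.1 : Matrix (Fin N) (Fin N) ℂ) * genSU (EuclideanSpace.single i.2 (1 : ℝ)) *
            star (u₀ z i.1 : Matrix (Fin N) (Fin N) ℂ) else 0) p.1 i bond) * (((fun (z : Z) (bond : PBond P j) =>
        Unitary.toUnits (toUnitary (Function.updateFinset (xext z) Λ (fun b' : ↥Λ => u₀ z (b' : PBond P j)) bond))) p.1 bond : (Matrix (Fin N) (Fin N) ℂ)ˣ) : Matrix (Fin N) (Fin N) ℂ))‖) < θ → p ∈ C →
      p.2 ∈ K p.1 → 0 ≤ (c p.1 - m p.1) ⬝ᵥ (A *ᵥ (p.2 - c p.1)))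
    (hfar : ∀ p : Z × (↥Λ × Fin (dimSU N) → ℝ), θ * (1 - ρ) ≤ (⨆ q, ‖Ψ q p.1 (fun bond => exp (∑ i : ↥Λ × Fin (dimSU N), ((p.2 i : ℝ) : ℂ) • (fun (z : Z) (i : ↥Λ × Fin (dimSU N)) (bond : PBond P j) =>
        if bond = (i.1 : PBond P j) then
          (u₀ z i.1 : Matrix (Fin N) (Fin N) ℂ) * genSU (EuclideanSpace.single i.2 (1 : ℝ)) *
            star (u₀ z i.1 : Matrix (Fin N) (Fin N) ℂ) else 0) p.1 i bond) * (((fun (z : Z) (bond : PBond P j) =>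
        Unitary.toUnits (toUnitary (Function.updateFinset (xext z) Λ (fun b' : ↥Λ => u₀ z (b' : PBond P j)) bond))) p.1 bond : (Matrix (Fin N) (Fin N) ℂ)ˣ) : Matrix (Fin N) (Fin N) ℂ))‖) → (⨆ q, ‖Ψ q p.1 (fun bond => exp (∑ i : ↥Λ × Fin (dimSU N), ((p.2 i : ℝ) : ℂ) • (fun (z : Z) (i : ↥Λ × Fin (dimSU N)) (bond : PBond P j) =>
        if bond = (i.1 : PBond P j) then
          (u₀ z i.1 : Matrix (Fin N) (Fin N) ℂ) * genSU (EuclideanSpace.single i.2 (1 : ℝ)) *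
            star (u₀ z i.1 : Matrix (Fin N) (Fin N) ℂ) else 0) p.1 i bond) * (((fun (z : Z) (bond : PBond P j) =>
        Unitary.toUnits (toUnitary (Function.updateFinset (xext z) Λ (fun b' : ↥Λ => u₀ z (b' : PBond P j)) bond))) p.1 bond : (Matrix (Fin N) (Fin N) ℂ)ˣ) : Matrix (Fin N) (Fin N) ℂ))‖) < θ → p ∈ C →
      p.2 ∈ K p.1 → 2 * G ≤ γ * ‖p.2 - c p.1‖)
    (henv : ∀ l ∈ Icc (1 - 1 / ((Fintype.card (↥Λ × Fin (dimSU N)) : ℝ) + 1)) 1, ∀ p : Z × (↥Λ × Fin (dimSU N) → ℝ),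
      θ * (1 - ρ) ≤ (⨆ q, ‖Ψ q p.1 (fun bond => exp (∑ i : ↥Λ × Fin (dimSU N), ((p.2 i : ℝ) : ℂ) • (fun (z : Z) (i : ↥Λ × Fin (dimSU N)) (bond : PBond P j) =>
        if bond = (i.1 : PBond P j) then
          (u₀ z i.1 : Matrix (Fin N) (Fin N) ℂ) * genSU (EuclideanSpace.single i.2 (1 : ℝ)) *
            star (u₀ z i.1 : Matrix (Fin N) (Fin N) ℂ) else 0) p.1 i bond) * (((fun (z : Z) (bond : PBond P j) =>
        Unitary.toUnits (toUnitary (Function.updateFinset (xext z) Λ (fun b' : ↥Λ => u₀ z (b' : PBond P j)) bond))) p.1 bond : (Matrix (Fin N) (Fin N) ℂ)ˣ) : Matrix (Fin N) (Fin N) ℂ))‖) → (⨆ q, ‖Ψ q p.1 (fun bond => exp (∑ i : ↥Λ × Fin (dimSU N), ((p.2 i : ℝ) : ℂ) • (fun (z : Z) (i : ↥Λ × Fin (dimSU N)) (bond : PBond P j) =>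
        if bond = (i.1 : PBond P j) then
          (u₀ z i.1 : Matrix (Fin N) (Fin N) ℂ) * genSU (EuclideanSpace.single i.2 (1 : ℝ)) *
            star (u₀ z i.1 : Matrix (Fin N) (Fin N) ℂ) else 0) p.1 i bond) * (((fun (z : Z) (bond : PBond P j) =>
        Unitary.toUnits (toUnitary (Function.updateFinset (xext z) Λ (fun b' : ↥Λ => u₀ z (b' : PBond P j)) bond))) p.1 bond : (Matrix (Fin N) (Fin N) ℂ)ˣ) : Matrix (Fin N) (Fin N) ℂ))‖) < θ → p ∈ C → (p.1, c p.1 + l • (p.2 - c p.1)) ∈ Env)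
    (hQ : ((ζ.prod volume).withDensity (fun p : Z × (↥Λ × Fin (dimSU N) → ℝ) => (K p.1).indicator (fun w => ENNReal.ofReal (Real.exp
        (-(1 / 2 * ((w - m p.1) ⬝ᵥ (A *ᵥ (w - m p.1))) + Pz p.1 w)))) p.2)) (Env \ ({p | (⨆ q, ‖Ψ q p.1 (fun bond => exp (∑ i : ↥Λ × Fin (dimSU N), ((p.2 i : ℝ) : ℂ) • (fun (z : Z) (i : ↥Λ × Fin (dimSU N)) (bond : PBond P j) =>
        if bond = (i.1 : PBond P j) then
          (u₀ z i.1 : Matrix (Fin N) (Fin N) ℂ) * genSU (EuclideanSpace.single i.2 (1 : ℝ)) *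
            star (u₀ z i.1 : Matrix (Fin N) (Fin N) ℂ) else 0) p.1 i bond) * (((fun (z : Z) (bond : PBond P j) =>
        Unitary.toUnits (toUnitary (Function.updateFinset (xext z) Λ (fun b' : ↥Λ => u₀ z (b' : PBond P j)) bond))) p.1 bond : (Matrix (Fin N) (Fin N) ℂ)ˣ) : Matrix (Fin N) (Fin N) ℂ))‖) < θ} ∩ C))
      ≤ ENNReal.ofReal Q * ((ζ.prod volume).withDensity (fun p : Z × (↥Λ × Fin (dimSU N) → ℝ) => (K p.1).indicator (fun w => ENNReal.ofReal (Real.exp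
        (-(1 / 2 * ((w - m p.1) ⬝ᵥ (A *ᵥ (w - m p.1))) + Pz p.1 w)))) p.2)) ({p | (⨆ q, ‖Ψ q p.1 (fun bond => exp (∑ i : ↥Λ × Fin (dimSU N), ((p.2 i : ℝ) : ℂ) • (fun (z : Z) (i : ↥Λ × Fin (dimSU N)) (bond : PBond P j) =>
        if bond = (i.1 : PBond P j) then
          (u₀ z i.1 : Matrix (Fin N) (Fin N) ℂ) * genSU (EuclideanSpace.single i.2 (1 : ℝ)) *
            star (u₀ z i.1 : Matrix (Fin N) (Fin N) ℂ) else 0) p.1 i bond) * (((fun (z : Z) (bond : PBond P j) =>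
        Unitary.toUnits (toUnitary (Function.updateFinset (xext z) Λ (fun b' : ↥Λ => u₀ z (b' : PBond P j)) bond))) p.1 bond : (Matrix (Fin N) (Fin N) ℂ)ˣ) : Matrix (Fin N) (Fin N) ℂ))‖) < θ} ∩ C)) :
    SlotAntiConcentration
      ((((ζ.prod volume).withDensity (fun p : Z × (↥Λ × Fin (dimSU N) → ℝ) => (K p.1).indicator (fun w => ENNReal.ofReal (Real.exp
        (-(1 / 2 * ((w - m p.1) ⬝ᵥ (A *ᵥ (w - m p.1))) + Pz p.1 w)))) p.2))).restrict ({p | (⨆ q, ‖Ψ q p.1 (fun bond => exp (∑ i : ↥Λ × Fin (dimSU N), ((p.2 i : ℝ) : ℂ) • (fun (z : Z) (i : ↥Λ × Fin (dimSU N)) (bond : PBond P j) =>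
        if bond = (i.1 : PBond P j) then
          (u₀ z i.1 : Matrix (Fin N) (Fin N) ℂ) * genSU (EuclideanSpace.single i.2 (1 : ℝ)) *
            star (u₀ z i.1 : Matrix (Fin N) (Fin N) ℂ) else 0) p.1 i bond) * (((fun (z : Z) (bond : PBond P j) =>
        Unitary.toUnits (toUnitary (Function.updateFinset (xext z) Λ (fun b' : ↥Λ => u₀ z (b' : PBond P j)) bond))) p.1 bond : (Matrix (Fin N) (Fin N) ℂ)ˣ) : Matrix (Fin N) (Fin N) ℂ))‖) < θ} ∩ C))
      (fun p : Z × (↥Λ × Fin (dimSU N) → ℝ) => (⨆ q, ‖Ψ q p.1 (fun bond => exp (∑ i : ↥Λ × Fin (dimSU N), ((p.2 i : ℝ) : ℂ) • (fun (z : Z) (i : ↥Λ × Fin (dimSU N)) (bond : PBond P j) =>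
        if bond = (i.1 : PBond P j) then
          (u₀ z i.1 : Matrix (Fin N) (Fin N) ℂ) * genSU (EuclideanSpace.single i.2 (1 : ℝ)) *
            star (u₀ z i.1 : Matrix (Fin N) (Fin N) ℂ) else 0) p.1 i bond) * (((fun (z : Z) (bond : PBond P j) =>
        Unitary.toUnits (toUnitary (Function.updateFinset (xext z) Λ (fun b' : ↥Λ => u₀ z (b' : PBond P j)) bond))) p.1 bond : (Matrix (Fin N) (Fin N) ℂ)ˣ) : Matrix (Fin N) (Fin N) ℂ))‖)) θ ρ
      (3 * ((Fintype.card (↥Λ × Fin (dimSU N)) : ℝ) + 1) * (1 + Q) / (κ₀ * (1 - ρ))) :=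
  slotAntiConcentration_restrict_of_projectedCentre_blockExpChart_regular (𝔄 := Matrix (Fin N) (Fin N) ℂ)
    ζ A hA hγ0 hγ m hc Pz (fun (z : Z) (i : ↥Λ × Fin (dimSU N)) (bond : PBond P j) =>
        if bond = (i.1 : PBond P j) then
          (u₀ z i.1 : Matrix (Fin N) (Fin N) ℂ) * genSU (EuclideanSpace.single i.2 (1 : ℝ)) *
            star (u₀ z i.1 : Matrix (Fin N) (Fin N) ℂ) else 0) (fun (z : Z) (bond : PBond P j) =>
        Unitary.toUnits (toUnitary (Function.updateFinset (xext z) Λ (fun b' : ↥Λ => u₀ z (b' : PBond P j)) bond)))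
    dirLetter_nonneg (fun z bond => sum_norm_blockDir_le Λ (u₀ z) bond) zero_le_one
    (fun z bond => norm_baseUnit_le_one Λ (u₀ z) (xext z) bond)
    (fun z bond => norm_inv_baseUnit_le_one Λ (u₀ z) (xext z) bond)
    hr hS0 hsmall plaqs hbudget Ψ hΨd hΨS K hKϱ hreg hg hKR hRr hc₀ hUm hC hEnv hCK hθ hρ0 hρ1 hκ hQ0 hnum hK hcK
    hP hobt hfar henv hQ

end Summit.QuantumFields.YangMills.Theorems.N21ResponseRoadAtSUNBlockChartRT
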